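import Literature.Barriers.QuantumAdvantage.UncorrectedNoiseMachineSubsets
import Literature.Barriers.QuantumAdvantage.UncorrectedNoiseMachineGates
import Literature.Barriers.QuantumAdvantage.UncorrectedNoiseCoefficients
import HarnessLib

/-!
# The noisy-IQP simulating machine, IV: the integer Fourier coefficient of one subset

Support file for the discharge of `bremnerMontanaroShepherd2017_thm4`
(`Literature/Barriers/QuantumAdvantage/UncorrectedNoise.lean`). For a canonical tuple coding a
subset `S` (`|S| ≤ ℓ`), the machine of Bremner–Montanaro–Shepherd 2017, §3.1 stores the damped
coefficient; in the tree's exact form this is the integer `coefInt P C R2 gates z S`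
(`UncorrectedNoiseCoefficients.lean`). This file writes the `FP` string function `qFn ℓ P C R2`
computing its pair code `dpEnc (coefInt …)` from `⟨⟨x, ⟨1^N, G⟩⟩, T⟩` (input bits, ruler,
gate-code list; tuple code), and proves that value (`qFn_apply`):

* small bricks `bitIsTrueFn`, `modKFn K` (`1^{|w| mod K}`), `divKFn K` (`1^{|w| / K}`);
* the wire code `wireCodeFn ⟨⟨1^N, ⟨G, T⟩⟩, 1^i⟩ = tripleCode (wireTriple s_i t_i λ_i)` — the
  value table `wireCode` of `UncorrectedNoiseCoefficients.lean` read by nested one-bit branches on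
  `t mod 2`, `(q + λ) mod 2` (`wireCodeFn_apply`, `wireTriple_spec`);
* the accumulation step `opWireFn` (zero flag `∨`, `Σe mod 4`, `Σa`) of additive growth, the wire
  loop `foldLoop opWireFn (clipF 14 wireCodeFn)` and its value (`qAccFn_qArg`, `accTriple_closed`:
  `anyZero`, `totE mod 4`, `totA`);
* sign parity (`#Z on S + #CZ in S + #{j : x[p_j] = 1} + ⌊(Σe mod 4)/2⌋`), the damping constant
  `bin C_{|S|}` looked up by `|S|`, the magnitude `bin (C_{|S|}·(2^P | R2)·2^{⌊Σa/2⌋})`, and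
  **`qFn_apply`**: `qFn ⟨⟨x, ⟨1^N, G⟩⟩, tupleCode l⟩ = dpEnc (coefInt P C R2 gates (zOfInput N x) (tupleShift N l))`
  for canonical `l` of length `≤ ℓ` with entries `≤ N` and `|x| ≤ N`.

## References

* [BremnerMontanaroShepherd2017] M. J. Bremner, A. Montanaro, D. J. Shepherd, *Achieving quantum
  supremacy with sparse and noisy commuting quantum computations*, Quantum 1 (2017) 8, §3.1.
* S. Arora, B. Barak, *Computational Complexity: A Modern Approach*, CUP 2009, §1.3.
-/

namespace Literature.Barriers.QuantumAdvantage.NoisyIQPMachine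

open _root_.Computability Literature.Computability.Complexity Literature.Computability.Complexity.Brick
  Literature.Computability.Complexity.Plumb Literature.Computability.Cryptography

variable {N : ℕ}

/-! ### Small one-bit bricks -/

/-- `[w = [1]]`, one-bit on every string. [folklore] -/
noncomputable def bitIsTrueFn : List Bool → List Bool := eqPairFn ∘ fanoutFn id (fun _ => [true])

/-- `bitIsTrueFn ∈ FP`. [folklore] -/
theorem bitIsTrueFn_mem_FP : bitIsTrueFn ∈ FP :=
  comp_mem_FP eqPairFn_mem_FP (fanoutFn_mem_FP OracleCompose.id_mem_FP (const_mem_FP _))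

/-- `bitIsTrueFn` is one-bit. [folklore] -/
theorem oneBit_bitIsTrueFn : OneBit bitIsTrueFn := oneBit_eqPairFn.comp _

/-- Value of `bitIsTrueFn`. [folklore] -/
@[simp] theorem bitIsTrueFn_apply (w : List Bool) : bitIsTrueFn w = [decide (w = [true])] := by
  simp [bitIsTrueFn, eqPairFn_boolPair]

/-- `modKFn K w = 1^{|w| mod K}` (unary residue of a unary numeral). [folklore] -/
noncomputable def modKFn (K : ℕ) : List Bool → List Bool := modLenFn ∘ fanoutFn (fun _ => ones K) id

/-- `modKFn K ∈ FP`. [folklore] -/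
theorem modKFn_mem_FP (K : ℕ) : modKFn K ∈ FP :=
  comp_mem_FP modLenFn_mem_FP (fanoutFn_mem_FP (const_mem_FP _) OracleCompose.id_mem_FP)

/-- Value of `modKFn`. [folklore] -/
@[simp] theorem modKFn_apply (K : ℕ) (w : List Bool) : modKFn K w = ones (w.length % K) := by
  simp [modKFn]

/-- `modKFn K w` is shorter than `K` (for `0 < K`). [folklore] -/
theorem length_modKFn_lt {K : ℕ} (hK : 0 < K) (w : List Bool) : (modKFn K w).length < K := by
  rw [modKFn_apply, List.length_replicate]; exact Nat.mod_lt _ hK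

/-- `divKFn K w = 1^{|w| / K}`. [folklore] -/
noncomputable def divKFn (K : ℕ) : List Bool → List Bool := fstF ∘ divModFn ∘ fanoutFn (fun _ => ones K) onesFn

/-- `divKFn K ∈ FP`. [folklore] -/
theorem divKFn_mem_FP (K : ℕ) : divKFn K ∈ FP :=
  comp_mem_FP fstF_mem_FP (comp_mem_FP divModFn_mem_FP (fanoutFn_mem_FP (const_mem_FP _) onesFn_mem_FP))

/-- `onesFn w = 1^{|w|}` (twin of `…Cryptography.CondRed.onesFn_eq_ones` of
`Cryptography/LiuPassCondRedProgram.lean`, outside this file's import closure). [folklore] -/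
theorem onesFn_eq_ones (w : List Bool) : onesFn w = ones w.length := by
  rw [onesFn, unaryEncodeNat_eq_replicate]

/-- Value of `divKFn`. [folklore] -/
@[simp] theorem divKFn_apply (K : ℕ) (w : List Bool) : divKFn K w = ones (w.length / K) := by
  simp [divKFn, onesFn_eq_ones]

/-- `isNilFn` on a unary numeral (twin of `…Complexity.IWStrongM.isNilFn_ones` of
`Complexity/IWStrongMachine.lean`, outside this file's import closure). [folklore] -/
theorem isNilFn_ones (k : ℕ) : isNilFn (ones k) = [decide (k = 0)] := by
  simp only [isNilFn]
  congr 1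
  rw [decide_eq_decide]
  constructor
  · intro h; simpa using congrArg List.length h
  · rintro rfl; rfl

/-! ### The wire code of one wire

Argument of the wire piece function: `⟨y, 1^i⟩` with the loop context `y = ⟨1^N, ⟨G, T⟩⟩`. -/

/-- The statistics context `⟨⟨1^N, ⟨1^i, T⟩⟩, G⟩` assembled from `⟨y, 1^i⟩`. [folklore] -/
noncomputable def wStatArg : List Bool → List Bool :=
  fanoutFn (fanoutFn (fstF ∘ fstF) (fanoutFn sndF (sndPow 1 ∘ fstF))) (nthF 1 ∘ fstF)

/-- `wStatArg ∈ FP`. [folklore] -/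
theorem wStatArg_mem_FP : wStatArg ∈ FP :=
  fanoutFn_mem_FP (fanoutFn_mem_FP (comp_mem_FP fstF_mem_FP fstF_mem_FP) (fanoutFn_mem_FP sndF_mem_FP
    (comp_mem_FP (sndPow_mem_FP 1) fstF_mem_FP))) (comp_mem_FP (nthF_mem_FP 1) fstF_mem_FP)

/-- The loop context of the wire loop. [folklore] -/
def wCtx (N : ℕ) (G T : List Bool) : List Bool := boolPair (ones N) (boolPair G T)

/-- Value of `wStatArg`. [folklore] -/
@[simp] theorem wStatArg_apply (G T : List Bool) (i : ℕ) :
    wStatArg (boolPair (wCtx N G T) (ones i)) = boolPair (statCtx N i T) G := by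
  simp [wStatArg, wCtx, statCtx, sndPow, nthF]

/-- `1^{t_i}`. [folklore] -/
noncomputable def wTFn : List Bool → List Bool := tCountFn ∘ wStatArg
/-- `1^{λ_i}`. [folklore] -/
noncomputable def wLamFn : List Bool → List Bool := lamCntFn ∘ wStatArg
/-- `[s_i]` (membership of the current wire in the tuple). [folklore] -/
noncomputable def wSiFn : List Bool → List Bool := memTupleFn ∘ fanoutFn sndF (sndPow 1 ∘ fstF)
/-- `1^{q}`, `q = (t mod 8) / 2`. [folklore] -/
noncomputable def wQFn : List Bool → List Bool := divKFn 2 ∘ modKFn 8 ∘ wTFn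
/-- `1^{b}`, `b = t mod 2`. [folklore] -/
noncomputable def wBFn : List Bool → List Bool := modKFn 2 ∘ wTFn
/-- `1^{λ mod 2}`. [folklore] -/
noncomputable def wD2Fn : List Bool → List Bool := modKFn 2 ∘ wLamFn
/-- `1^{(q + λ) mod 2}`. [folklore] -/
noncomputable def wQdFn : List Bool → List Bool := modKFn 2 ∘ appF ∘ fanoutFn wQFn wD2Fn

/-- `wTFn ∈ FP`. [folklore] -/
theorem wTFn_mem_FP : wTFn ∈ FP := comp_mem_FP tCountFn_mem_FP wStatArg_mem_FP
/-- `wLamFn ∈ FP`. [folklore] -/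
theorem wLamFn_mem_FP : wLamFn ∈ FP := comp_mem_FP lamCntFn_mem_FP wStatArg_mem_FP
/-- `wSiFn ∈ FP`. [folklore] -/
theorem wSiFn_mem_FP : wSiFn ∈ FP :=
  comp_mem_FP memTupleFn_mem_FP (fanoutFn_mem_FP sndF_mem_FP (comp_mem_FP (sndPow_mem_FP 1) fstF_mem_FP))
/-- `wQFn ∈ FP`. [folklore] -/
theorem wQFn_mem_FP : wQFn ∈ FP := comp_mem_FP (divKFn_mem_FP 2) (comp_mem_FP (modKFn_mem_FP 8) wTFn_mem_FP)
/-- `wBFn ∈ FP`. [folklore] -/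
theorem wBFn_mem_FP : wBFn ∈ FP := comp_mem_FP (modKFn_mem_FP 2) wTFn_mem_FP
/-- `wD2Fn ∈ FP`. [folklore] -/
theorem wD2Fn_mem_FP : wD2Fn ∈ FP := comp_mem_FP (modKFn_mem_FP 2) wLamFn_mem_FP
/-- `wQdFn ∈ FP`. [folklore] -/
theorem wQdFn_mem_FP : wQdFn ∈ FP :=
  comp_mem_FP (modKFn_mem_FP 2) (comp_mem_FP appF_mem_FP (fanoutFn_mem_FP wQFn_mem_FP wD2Fn_mem_FP))

/-- `wSiFn` is one-bit. [folklore] -/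
theorem oneBit_wSiFn : OneBit wSiFn := oneBit_memTupleFn.comp _

/-- The zero bit of the wire code (value table of `UncorrectedNoiseCoefficients.wireCode`). [folklore] -/
noncomputable def wZeroFn : List Bool → List Bool :=
  iteFn wSiFn (iteFn (isNilFn ∘ wBFn) (notFn (isNilFn ∘ wQdFn)) (fun _ => [false])) (notFn (isNilFn ∘ wD2Fn))

/-- The `i`-exponent part `1^{e}` of the wire code. [folklore] -/
noncomputable def wEFn : List Bool → List Bool :=
  iteFn wSiFn (iteFn (isNilFn ∘ wBFn) (modKFn 4 ∘ wQFn) (modKFn 4 ∘ appF ∘ fanoutFn wQFn wQdFn)) (fun _ => [])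

/-- The `√2`-exponent part `1^{a}` of the wire code. [folklore] -/
noncomputable def wAFn : List Bool → List Bool :=
  iteFn wSiFn (iteFn (isNilFn ∘ wBFn) (fun _ => ones 2) (fun _ => ones 1)) (fun _ => ones 2)

/-- **The wire code function** `⟨y, 1^i⟩ ↦ ⟨[zero?], ⟨1^{e}, 1^{a}⟩⟩`. [folklore] -/
noncomputable def wireCodeFn : List Bool → List Bool := fanoutFn wZeroFn (fanoutFn wEFn wAFn)

/-- `wZeroFn ∈ FP`. [folklore] -/
theorem wZeroFn_mem_FP : wZeroFn ∈ FP :=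
  iteFn_mem_FP wSiFn_mem_FP (iteFn_mem_FP (comp_mem_FP isNilFn_mem_FP wBFn_mem_FP)
    (notFn_mem_FP (comp_mem_FP isNilFn_mem_FP wQdFn_mem_FP)) (const_mem_FP _))
    (notFn_mem_FP (comp_mem_FP isNilFn_mem_FP wD2Fn_mem_FP))
/-- `wEFn ∈ FP`. [folklore] -/
theorem wEFn_mem_FP : wEFn ∈ FP :=
  iteFn_mem_FP wSiFn_mem_FP (iteFn_mem_FP (comp_mem_FP isNilFn_mem_FP wBFn_mem_FP)
    (comp_mem_FP (modKFn_mem_FP 4) wQFn_mem_FP)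
    (comp_mem_FP (modKFn_mem_FP 4) (comp_mem_FP appF_mem_FP (fanoutFn_mem_FP wQFn_mem_FP wQdFn_mem_FP)))) (const_mem_FP _)
/-- `wAFn ∈ FP`. [folklore] -/
theorem wAFn_mem_FP : wAFn ∈ FP :=
  iteFn_mem_FP wSiFn_mem_FP (iteFn_mem_FP (comp_mem_FP isNilFn_mem_FP wBFn_mem_FP) (const_mem_FP _) (const_mem_FP _))
    (const_mem_FP _)
/-- `wireCodeFn ∈ FP`. [folklore] -/
theorem wireCodeFn_mem_FP : wireCodeFn ∈ FP := fanoutFn_mem_FP wZeroFn_mem_FP (fanoutFn_mem_FP wEFn_mem_FP wAFn_mem_FP)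

/-- The machine's reading of the value table: the code computed from `(s_i, t, λ)` — the zero
bit is `wireCode = none`, and on `some (e, a)` the exponents are `(e, a)`; on `none` the
exponents are whatever the branch produced (irrelevant downstream). [folklore] -/
def wireTriple (si : Bool) (t d : ℕ) : Bool × ℕ × ℕ :=
  if si = true then
    if t % 2 = 0 then (decide ((t % 8 / 2 + d) % 2 ≠ 0), t % 8 / 2 % 4, 2)
    else (false, (t % 8 / 2 + (t % 8 / 2 + d) % 2) % 4, 1)
  else (decide (d % 2 ≠ 0), 0, 2)

/-- `wireTriple` agrees with `wireCode`: zero bit and, when nonzero, the exponents. [folklore] -/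
theorem wireTriple_spec (si : Bool) (t d : ℕ) :
    ((wireTriple si t d).1 = true ↔ wireCode si t d = none) ∧
    (∀ e a, wireCode si t d = some (e, a) → (wireTriple si t d).2 = (e, a)) ∧
    (wireTriple si t d).2.1 < 4 ∧ (wireTriple si t d).2.2 ≤ 2 := by
  unfold wireTriple wireCode
  cases si
  · by_cases hd : d % 2 = 0 <;> simp [hd]
  · by_cases hb : t % 2 = 0
    · by_cases hq : (t % 8 / 2 + d) % 2 = 0
      · simp [hb, hq]; omega
      · simp [hb, hq]; omega
    · simp [hb]; omega

/-- The code string of a triple. [folklore] -/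
def tripleCode (c : Bool × ℕ × ℕ) : List Bool := boolPair [c.1] (boolPair (ones c.2.1) (ones c.2.2))

section WireValues

variable (L : List (QGate iqpDiag N)) (l : List ℕ) (i : Fin N)

/-- The tuple shift agrees with the indicator of the coded subset. [folklore] -/
theorem tupleShift_apply (w : Fin N) : tupleShift N l w = decide ((w : ℕ) ∈ l) := rfl

/-- Value of `wTFn`: `1^{t_i}`. [folklore] -/
theorem wTFn_apply : wTFn (boolPair (wCtx N (encList (L.map QGate.encode)) (tupleCode l)) (ones i)) = ones (tCountW L i) := by
  rw [wTFn, Function.comp_apply, wStatArg_apply, tCountFn_apply, tCountW_eq_countP]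

/-- Value of `wLamFn`: `1^{λ_i}`. [folklore] -/
theorem wLamFn_apply : wLamFn (boolPair (wCtx N (encList (L.map QGate.encode)) (tupleCode l)) (ones i)) =
    ones (czDeg L (tupleShift N l) i) := by
  rw [wLamFn, Function.comp_apply, wStatArg_apply, lamCntFn_apply, czDeg_eq_countP]

/-- Value of `wSiFn`: `[s_i]`. [folklore] -/
theorem wSiFn_apply (G : List Bool) : wSiFn (boolPair (wCtx N G (tupleCode l)) (ones i)) = [tupleShift N l i] := by
  simp only [wSiFn, wCtx, Function.comp_apply, fanoutFn_apply, sndF_boolPair, fstF_boolPair, sndPow]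
  rw [memTupleFn_apply]; rfl

/-- **Value of the wire code function.** [folklore] -/
theorem wireCodeFn_apply : wireCodeFn (boolPair (wCtx N (encList (L.map QGate.encode)) (tupleCode l)) (ones i)) =
    tripleCode (wireTriple (tupleShift N l i) (tCountW L i) (czDeg L (tupleShift N l) i)) := by
  set w := boolPair (wCtx N (encList (L.map QGate.encode)) (tupleCode l)) (ones i) with hw
  set t := tCountW L i
  set d := czDeg L (tupleShift N l) i
  have hT : wTFn w = ones t := wTFn_apply L l i
  have hLam : wLamFn w = ones d := wLamFn_apply L l i
  have hSi : wSiFn w = [tupleShift N l i] := wSiFn_apply l i _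
  have hQ : wQFn w = ones (t % 8 / 2) := by simp [wQFn, hT]
  have hB : wBFn w = ones (t % 2) := by simp [wBFn, hT]
  have hD2 : wD2Fn w = ones (d % 2) := by simp [wD2Fn, hLam]
  have hQd : wQdFn w = ones ((t % 8 / 2 + d % 2) % 2) := by simp [wQdFn, hQ, hD2]
  have hqd : (t % 8 / 2 + d % 2) % 2 = (t % 8 / 2 + d) % 2 := by omega
  have onesNil : ∀ k : ℕ, (ones k = []) ↔ k = 0 := fun k => by
    constructor
    · intro h; simpa using congrArg List.length h
    · rintro rfl; rfl
  have isNil_ones : ∀ k : ℕ, isNilFn (ones k) = [decide (k = 0)] := fun k => by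
    simp only [isNilFn]; congr 1; rw [decide_eq_decide]; exact onesNil k
  -- the three components
  have hZ : wZeroFn w = [(wireTriple (tupleShift N l i) t d).1] := by
    unfold wZeroFn wireTriple
    rw [iteFn_apply hSi]
    cases tupleShift N l i
    · simp only [Bool.false_eq_true, if_false]
      rw [notFn_apply (b := decide (d % 2 = 0)) (by rw [Function.comp_apply, hD2, isNil_ones])]
      by_cases h : d % 2 = 0 <;> simp [h]
    · simp only [if_true]
      rw [iteFn_apply (b := decide (t % 2 = 0)) (by rw [Function.comp_apply, hB, isNil_ones])]
      by_cases hb : t % 2 = 0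
      · rw [if_pos (decide_eq_true hb), notFn_apply (b := decide ((t % 8 / 2 + d % 2) % 2 = 0))
          (by rw [Function.comp_apply, hQd, isNil_ones]), if_pos hb, hqd]
        by_cases h : (t % 8 / 2 + d) % 2 = 0 <;> simp [h]
      · rw [if_neg (by simp [hb]), if_neg hb]
  have hE : wEFn w = ones (wireTriple (tupleShift N l i) t d).2.1 := by
    unfold wEFn wireTriple
    rw [iteFn_apply hSi]
    cases tupleShift N l i
    · simp
    · simp only [if_true]
      rw [iteFn_apply (b := decide (t % 2 = 0)) (by rw [Function.comp_apply, hB, isNil_ones])]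
      by_cases hb : t % 2 = 0
      · rw [if_pos (decide_eq_true hb), if_pos hb]; simp [hQ]
      · rw [if_neg (by simp [hb]), if_neg hb]
        simp [hQ, hQd, hqd]
  have hA : wAFn w = ones (wireTriple (tupleShift N l i) t d).2.2 := by
    unfold wAFn wireTriple
    rw [iteFn_apply hSi]
    cases tupleShift N l i
    · simp
    · simp only [if_true]
      rw [iteFn_apply (b := decide (t % 2 = 0)) (by rw [Function.comp_apply, hB, isNil_ones])]
      by_cases hb : t % 2 = 0
      · rw [if_pos (decide_eq_true hb), if_pos hb]
      · rw [if_neg (by simp [hb]), if_neg hb]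
  rw [wireCodeFn, fanoutFn_apply, fanoutFn_apply, hZ, hE, hA, tripleCode]

/-- The wire code is short: at most `14` symbols. [folklore] -/
theorem length_tripleCode_le (c : Bool × ℕ × ℕ) (h1 : c.2.1 < 4) (h2 : c.2.2 ≤ 2) : (tripleCode c).length ≤ 14 := by
  simp only [tripleCode, length_boolPair, List.length_singleton, List.length_replicate]
  omega

end WireValues

/-! ### Accumulating the wire codes: zero flag, `Σe mod 4`, `Σa` -/

/-- The accumulation step `⟨acc, code⟩ ↦ ⟨[zero ∨ zero'], ⟨1^{(e+e') mod 4}, 1^{a+a'}⟩⟩`. [folklore] -/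
noncomputable def opWireFn : List Bool → List Bool :=
  fanoutFn (orFn (bitIsTrueFn ∘ fstF ∘ fstF) (bitIsTrueFn ∘ fstF ∘ sndF))
    (fanoutFn (modKFn 4 ∘ appF ∘ fanoutFn (nthF 1 ∘ fstF) (nthF 1 ∘ sndF))
      (appF ∘ fanoutFn (sndPow 1 ∘ fstF) (sndPow 1 ∘ sndF)))

/-- `opWireFn ∈ FP`. [folklore] -/
theorem opWireFn_mem_FP : opWireFn ∈ FP :=
  fanoutFn_mem_FP (orFn_mem_FP (comp_mem_FP bitIsTrueFn_mem_FP (comp_mem_FP fstF_mem_FP fstF_mem_FP))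
    (comp_mem_FP bitIsTrueFn_mem_FP (comp_mem_FP fstF_mem_FP sndF_mem_FP)))
    (fanoutFn_mem_FP (comp_mem_FP (modKFn_mem_FP 4) (comp_mem_FP appF_mem_FP (fanoutFn_mem_FP
      (comp_mem_FP (nthF_mem_FP 1) fstF_mem_FP) (comp_mem_FP (nthF_mem_FP 1) sndF_mem_FP))))
      (comp_mem_FP appF_mem_FP (fanoutFn_mem_FP (comp_mem_FP (sndPow_mem_FP 1) fstF_mem_FP) (comp_mem_FP (sndPow_mem_FP 1) sndF_mem_FP))))

/-- **Growth of the accumulation step**: additive (`+ 12`). [folklore] -/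
theorem length_opWireFn_le (w : List Bool) : (opWireFn w).length ≤ (fstF w).length + (sndF w).length + 12 := by
  have hor := (oneBit_orFn (oneBit_bitIsTrueFn.comp (fstF ∘ fstF)) (oneBit_bitIsTrueFn.comp (fstF ∘ sndF))).length_eq w
  have hmod := length_modKFn_lt (by norm_num : 0 < 4) ((appF ∘ fanoutFn (nthF 1 ∘ fstF) (nthF 1 ∘ sndF)) w)
  have h1 := length_sndPow_le 1 (fstF w)
  have h2 := length_sndPow_le 1 (sndF w)
  simp only [opWireFn, fanoutFn_apply, length_boolPair, Function.comp_apply, appF_boolPair, List.length_append] at hor hmod ⊢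
  rw [hor]
  omega

/-- Value of the accumulation step on codes. [folklore] -/
theorem opWireFn_apply (z : Bool) (e a : ℕ) (c : Bool × ℕ × ℕ) :
    opWireFn (boolPair (tripleCode (z, e, a)) (tripleCode c)) = tripleCode (z || c.1, (e + c.2.1) % 4, a + c.2.2) := by
  obtain ⟨z', e', a'⟩ := c
  unfold opWireFn tripleCode
  rw [fanoutFn_apply, fanoutFn_apply, orFn_apply (b := z) (b' := z')]
  · simp [nthF, sndPow]
  · cases z <;> simp
  · cases z' <;> simp

/-- One accumulation step on triples. [folklore] -/
def accStep (acc c : Bool × ℕ × ℕ) : Bool × ℕ × ℕ := (acc.1 || c.1, (acc.2.1 + c.2.1) % 4, acc.2.2 + c.2.2)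

/-- The mathematical accumulation over the wires `i₀, …, i₀ + k − 1`. [folklore] -/
def accTriple (c : ℕ → Bool × ℕ × ℕ) (i₀ : ℕ) : ℕ → Bool × ℕ × ℕ → Bool × ℕ × ℕ
  | 0, acc => acc
  | k + 1, acc => accStep (accTriple c i₀ k acc) (c (i₀ + k))

/-- `opWireFn` on codes is `accStep`. [folklore] -/
theorem opWireFn_tripleCode (acc c : Bool × ℕ × ℕ) :
    opWireFn (boolPair (tripleCode acc) (tripleCode c)) = tripleCode (accStep acc c) := by
  obtain ⟨z, e, a⟩ := acc
  exact opWireFn_apply z e a c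

/-- **The fold computes `accTriple`** (when the piece function writes the codes `c` on the wires
that are folded). [folklore] -/
theorem foldAcc_opWireFn {f : List Bool → List Bool} {x : List Bool} {c : ℕ → Bool × ℕ × ℕ} {n : ℕ}
    (hf : ∀ j, j < n → f (boolPair x (ones j)) = tripleCode (c j)) (i₀ : ℕ) (acc : Bool × ℕ × ℕ) :
    ∀ k : ℕ, i₀ + k ≤ n → foldAcc opWireFn f x i₀ k (tripleCode acc) = tripleCode (accTriple c i₀ k acc)
  | 0, _ => rfl
  | k + 1, hk => by
    rw [foldAcc_succ', foldAcc_opWireFn hf i₀ acc k (by omega), hf _ (by omega), opWireFn_tripleCode, accTriple]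

/-- **Closed form of the accumulation**: zero flag = "some code is zero", exponents = sums
(`mod 4` for `e`). [folklore] -/
theorem accTriple_closed (c : ℕ → Bool × ℕ × ℕ) (i₀ : ℕ) (acc : Bool × ℕ × ℕ) (hacc : acc.2.1 < 4) :
    ∀ k : ℕ, accTriple c i₀ k acc =
      (acc.1 || decide (∃ j, j < k ∧ (c (i₀ + j)).1 = true),
        (acc.2.1 + ∑ j ∈ Finset.range k, (c (i₀ + j)).2.1) % 4, acc.2.2 + ∑ j ∈ Finset.range k, (c (i₀ + j)).2.2)
  | 0 => by
    obtain ⟨z, e, a⟩ := acc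
    simp [accTriple, Nat.mod_eq_of_lt hacc]
  | k + 1 => by
    rw [accTriple, accTriple_closed c i₀ acc hacc k, accStep]
    simp only [Finset.sum_range_succ, Prod.mk.injEq]
    refine ⟨?_, ?_, ?_⟩
    · rw [Bool.or_assoc]
      congr 1
      rw [Bool.eq_iff_iff]
      simp only [Bool.or_eq_true, decide_eq_true_eq]
      constructor
      · rintro (⟨j, hj, hj'⟩ | h0)
        · exact ⟨j, by omega, hj'⟩
        · exact ⟨k, by omega, h0⟩
      · rintro ⟨j, hj, hj'⟩
        rcases Nat.lt_succ_iff_lt_or_eq.1 hj with hj | rfl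
        · exact Or.inl ⟨j, hj, hj'⟩
        · exact Or.inr hj'
    · rw [Nat.mod_add_mod, add_assoc]
    · rw [add_assoc]

/-! ### The coefficient `Q` of a tuple

Argument: `w = ⟨⟨x, ⟨1^N, G⟩⟩, T⟩` (input bits, ruler, gate-list code; tuple code). -/

section QFn

variable (ℓ P : ℕ) (C : ℕ → ℕ) (R2 : ℕ)

/-- The input bits `x`. [folklore] -/
def qXOf : List Bool → List Bool := fstF ∘ fstF
/-- The ruler `1^N`. [folklore] -/
def qRulerOf : List Bool → List Bool := nthF 1 ∘ fstF
/-- The gate-list code `G`. [folklore] -/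
def qGOf : List Bool → List Bool := sndPow 1 ∘ fstF

/-- `qXOf ∈ FP`. [folklore] -/
theorem qXOf_mem_FP : qXOf ∈ FP := comp_mem_FP fstF_mem_FP fstF_mem_FP
/-- `qRulerOf ∈ FP`. [folklore] -/
theorem qRulerOf_mem_FP : qRulerOf ∈ FP := comp_mem_FP (nthF_mem_FP 1) fstF_mem_FP
/-- `qGOf ∈ FP`. [folklore] -/
theorem qGOf_mem_FP : qGOf ∈ FP := comp_mem_FP (sndPow_mem_FP 1) fstF_mem_FP

/-- The argument record of `Q`. [folklore] -/
def qArg (x : List Bool) (N : ℕ) (G T : List Bool) : List Bool := boolPair (boolPair x (boolPair (ones N) G)) T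

/-- Reading `x`. [folklore] -/
@[simp] theorem qXOf_qArg (x : List Bool) (N : ℕ) (G T : List Bool) : qXOf (qArg x N G T) = x := by simp [qXOf, qArg]
/-- Reading `1^N`. [folklore] -/
@[simp] theorem qRulerOf_qArg (x : List Bool) (N : ℕ) (G T : List Bool) : qRulerOf (qArg x N G T) = ones N := by
  simp [qRulerOf, qArg, nthF]
/-- Reading `G`. [folklore] -/
@[simp] theorem qGOf_qArg (x : List Bool) (N : ℕ) (G T : List Bool) : qGOf (qArg x N G T) = G := by
  simp [qGOf, qArg, sndPow]
/-- Reading `T`. [folklore] -/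
@[simp] theorem sndF_qArg (x : List Bool) (N : ℕ) (G T : List Bool) : sndF (qArg x N G T) = T := by simp [qArg]

/-- The start record of the wire loop: `⟨wCtx, ⟨bin N, ⟨1^0, code (ff, 0, 0)⟩⟩⟩`. [folklore] -/
noncomputable def qInitFn : List Bool → List Bool :=
  fanoutFn (fanoutFn qRulerOf (fanoutFn qGOf sndF))
    (fanoutFn (lenBinF ∘ qRulerOf) (fanoutFn (fun _ => []) (fun _ => tripleCode (false, 0, 0))))

/-- `qInitFn ∈ FP`. [folklore] -/
theorem qInitFn_mem_FP : qInitFn ∈ FP :=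
  fanoutFn_mem_FP (fanoutFn_mem_FP qRulerOf_mem_FP (fanoutFn_mem_FP qGOf_mem_FP sndF_mem_FP))
    (fanoutFn_mem_FP (comp_mem_FP lenBinF_mem_FP qRulerOf_mem_FP) (fanoutFn_mem_FP (const_mem_FP _) (const_mem_FP _)))

/-- Value of `qInitFn`. [folklore] -/
theorem qInitFn_qArg (x : List Bool) (N : ℕ) (G T : List Bool) : qInitFn (qArg x N G T) =
    boolPair (wCtx N G T) (boolPair (encodeNat N) (boolPair (ones 0) (tripleCode (false, 0, 0)))) := by
  simp [qInitFn, wCtx, lenBinF_apply]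

/-- **The accumulated wire code** `⟨[zero?], ⟨1^{Σe mod 4}, 1^{Σa}⟩⟩` (the wire loop). [folklore] -/
noncomputable def qAccFn : List Bool → List Bool :=
  sndPow 2 ∘ foldLoop opWireFn (clipF 14 wireCodeFn) Polynomial.X ∘ qInitFn

/-- `qAccFn ∈ FP`. [cite: AroraBarak2009, §1.3 (polynomially bounded loops)] -/
theorem qAccFn_mem_FP : qAccFn ∈ FP :=
  comp_mem_FP (sndPow_mem_FP 2) (comp_mem_FP (foldLoop_clipF_mem_FP 14 opWireFn_mem_FP length_opWireFn_le
    wireCodeFn_mem_FP _) qInitFn_mem_FP)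

/-- The wire codes as a sequence on `ℕ` (junk beyond `N`). [folklore] -/
def wireTripleAt (L : List (QGate iqpDiag N)) (l : List ℕ) (j : ℕ) : Bool × ℕ × ℕ :=
  if h : j < N then wireTriple (tupleShift N l ⟨j, h⟩) (tCountW L ⟨j, h⟩) (czDeg L (tupleShift N l) ⟨j, h⟩) else (false, 0, 0)

/-- **Value of `qAccFn`**: the accumulated triple over all wires. [folklore] -/
theorem qAccFn_qArg (L : List (QGate iqpDiag N)) (l : List ℕ) (x : List Bool) :
    qAccFn (qArg x N (encList (L.map QGate.encode)) (tupleCode l)) =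
      tripleCode (accTriple (wireTripleAt L l) 0 N (false, 0, 0)) := by
  rw [qAccFn, Function.comp_apply, Function.comp_apply, qInitFn_qArg,
    foldLoop_apply _ _ (by simp [wCtx]; omega) 0 _]
  simp only [sndPow, Function.comp_apply, sndF_boolPair, zero_add]
  have hf : ∀ j, j < N → wireCodeFn (boolPair (wCtx N (encList (L.map QGate.encode)) (tupleCode l)) (ones j)) =
      tripleCode (wireTripleAt L l j) := by
    intro j hj
    rw [wireCodeFn_apply L l ⟨j, hj⟩, wireTripleAt, dif_pos hj]
  rw [foldAcc_clipF, foldAcc_opWireFn hf 0 (false, 0, 0) N (by omega)]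
  intro j _ hj
  rw [hf j (by omega)]
  have hs := wireTriple_spec (tupleShift N l ⟨j, by omega⟩) (tCountW L ⟨j, by omega⟩) (czDeg L (tupleShift N l) ⟨j, by omega⟩)
  refine (length_tripleCode_le _ ?_ ?_).trans (by omega)
  · rw [wireTripleAt, dif_pos (by omega)]; exact hs.2.2.1
  · rw [wireTripleAt, dif_pos (by omega)]; exact hs.2.2.2

/-- The statistics context at wire `0`: `⟨1^N, ⟨ε, T⟩⟩`. [folklore] -/
noncomputable def qStat0Fn : List Bool → List Bool := fanoutFn qRulerOf (fanoutFn (fun _ => []) sndF)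

/-- `qStat0Fn ∈ FP`. [folklore] -/
theorem qStat0Fn_mem_FP : qStat0Fn ∈ FP := fanoutFn_mem_FP qRulerOf_mem_FP (fanoutFn_mem_FP (const_mem_FP _) sndF_mem_FP)

/-- `1^{#Z on S}`. [folklore] -/
noncomputable def qZOnFn : List Bool → List Bool := zOnFn ∘ fanoutFn qStat0Fn qGOf
/-- `1^{#CZ inside S}`. [folklore] -/
noncomputable def qCzInFn : List Bool → List Bool := czInFn ∘ fanoutFn qStat0Fn qGOf
/-- `1^{#{p ∈ T | x[p] = 1}}`. [folklore] -/
noncomputable def qMarkFn : List Bool → List Bool := markedCountFn ∘ fanoutFn qXOf sndF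
/-- `1^{⌊(Σe mod 4)/2⌋}`. [folklore] -/
noncomputable def qEHalfFn : List Bool → List Bool := divKFn 2 ∘ nthF 1 ∘ qAccFn
/-- **The sign parity** `1^{(#Z on S + #CZ in S + #marked + ⌊(Σe mod 4)/2⌋) mod 2}`. [folklore] -/
noncomputable def qSignParFn : List Bool → List Bool :=
  modKFn 2 ∘ appF ∘ fanoutFn (appF ∘ fanoutFn qZOnFn qCzInFn) (appF ∘ fanoutFn qMarkFn qEHalfFn)
/-- `1^{|S|}`. [folklore] -/
noncomputable def qSizeFn : List Bool → List Bool := sizeFn ∘ fanoutFn qRulerOf sndF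
/-- The damping constant `bin C_{|S|}`, looked up in the hard-wired list `[bin C₀, …, bin C_ℓ]`. [folklore] -/
noncomputable def qCSelFn : List Bool → List Bool :=
  HashBricks.nthItemFn ∘ fanoutFn qSizeFn (fun _ => encList ((List.range (ℓ + 1)).map fun j => encodeNat (C j)))
/-- `1^{⌊Σa/2⌋}`. [folklore] -/
noncomputable def qAHalfFn : List Bool → List Bool := divKFn 2 ∘ sndPow 1 ∘ qAccFn
/-- `1^{Σa mod 2}`. [folklore] -/
noncomputable def qAParFn : List Bool → List Bool := modKFn 2 ∘ sndPow 1 ∘ qAccFn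
/-- `bin (2^{⌊Σa/2⌋})` = `0^{⌊Σa/2⌋} 1`. [folklore] -/
noncomputable def qPow2Fn : List Bool → List Bool := fun w => Kannan.zerosFn (qAHalfFn w) ++ [true]
/-- The `√2`-correction constant: `bin (2^P)` if `Σa` is even, `bin R2` if odd. [folklore] -/
noncomputable def qShiftCFn : List Bool → List Bool :=
  iteFn (isNilFn ∘ qAParFn) (fun _ => encodeNat (2 ^ P)) (fun _ => encodeNat R2)
/-- **The magnitude** `bin (C_{|S|} · (2^P | R2) · 2^{⌊Σa/2⌋})`. [folklore] -/
noncomputable def qMagFn : List Bool → List Bool :=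
  prodFn ∘ fanoutFn (prodFn ∘ fanoutFn (qCSelFn ℓ C) (qShiftCFn P R2)) qPow2Fn
/-- **The coefficient** `Q = dpEnc (coefInt …)` of the tuple. [cite: BremnerMontanaroShepherd2017, §3.1 (storing the Fourier coefficients)] -/
noncomputable def qFn : List Bool → List Bool :=
  iteFn (bitIsTrueFn ∘ fstF ∘ qAccFn) (fun _ => dpEnc 0)
    (iteFn (isNilFn ∘ qSignParFn) (fanoutFn (qMagFn ℓ P C R2) (fun _ => [])) (fanoutFn (fun _ => []) (qMagFn ℓ P C R2)))

/-- `qZOnFn ∈ FP`. [folklore] -/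
theorem qZOnFn_mem_FP : qZOnFn ∈ FP := comp_mem_FP zOnFn_mem_FP (fanoutFn_mem_FP qStat0Fn_mem_FP qGOf_mem_FP)
/-- `qCzInFn ∈ FP`. [folklore] -/
theorem qCzInFn_mem_FP : qCzInFn ∈ FP := comp_mem_FP czInFn_mem_FP (fanoutFn_mem_FP qStat0Fn_mem_FP qGOf_mem_FP)
/-- `qMarkFn ∈ FP`. [folklore] -/
theorem qMarkFn_mem_FP : qMarkFn ∈ FP := comp_mem_FP markedCountFn_mem_FP (fanoutFn_mem_FP qXOf_mem_FP sndF_mem_FP)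
/-- `qEHalfFn ∈ FP`. [folklore] -/
theorem qEHalfFn_mem_FP : qEHalfFn ∈ FP := comp_mem_FP (divKFn_mem_FP 2) (comp_mem_FP (nthF_mem_FP 1) qAccFn_mem_FP)
/-- `qSignParFn ∈ FP`. [folklore] -/
theorem qSignParFn_mem_FP : qSignParFn ∈ FP :=
  comp_mem_FP (modKFn_mem_FP 2) (comp_mem_FP appF_mem_FP (fanoutFn_mem_FP
    (comp_mem_FP appF_mem_FP (fanoutFn_mem_FP qZOnFn_mem_FP qCzInFn_mem_FP))
    (comp_mem_FP appF_mem_FP (fanoutFn_mem_FP qMarkFn_mem_FP qEHalfFn_mem_FP))))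
/-- `qSizeFn ∈ FP`. [folklore] -/
theorem qSizeFn_mem_FP : qSizeFn ∈ FP := comp_mem_FP sizeFn_mem_FP (fanoutFn_mem_FP qRulerOf_mem_FP sndF_mem_FP)
/-- `qCSelFn ∈ FP`. [folklore] -/
theorem qCSelFn_mem_FP : qCSelFn ℓ C ∈ FP :=
  comp_mem_FP HashBricks.nthItemFn_mem_FP (fanoutFn_mem_FP qSizeFn_mem_FP (const_mem_FP _))
/-- `qAHalfFn ∈ FP`. [folklore] -/
theorem qAHalfFn_mem_FP : qAHalfFn ∈ FP := comp_mem_FP (divKFn_mem_FP 2) (comp_mem_FP (sndPow_mem_FP 1) qAccFn_mem_FP)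
/-- `qAParFn ∈ FP`. [folklore] -/
theorem qAParFn_mem_FP : qAParFn ∈ FP := comp_mem_FP (modKFn_mem_FP 2) (comp_mem_FP (sndPow_mem_FP 1) qAccFn_mem_FP)
/-- `qPow2Fn ∈ FP`. [folklore] -/
theorem qPow2Fn_mem_FP : qPow2Fn ∈ FP := append_mem_FP (comp_mem_FP Kannan.zerosFn_mem_FP qAHalfFn_mem_FP) (const_mem_FP _)
/-- `qShiftCFn ∈ FP`. [folklore] -/
theorem qShiftCFn_mem_FP : qShiftCFn P R2 ∈ FP :=
  iteFn_mem_FP (comp_mem_FP isNilFn_mem_FP qAParFn_mem_FP) (const_mem_FP _) (const_mem_FP _)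
/-- `qMagFn ∈ FP`. [folklore] -/
theorem qMagFn_mem_FP : qMagFn ℓ P C R2 ∈ FP :=
  comp_mem_FP prodFn_mem_FP (fanoutFn_mem_FP (comp_mem_FP prodFn_mem_FP (fanoutFn_mem_FP (qCSelFn_mem_FP ℓ C)
    (qShiftCFn_mem_FP P R2))) qPow2Fn_mem_FP)
/-- **`qFn ∈ FP`.** [cite: AroraBarak2009, §1.3] -/
theorem qFn_mem_FP : qFn ℓ P C R2 ∈ FP :=
  iteFn_mem_FP (comp_mem_FP bitIsTrueFn_mem_FP (comp_mem_FP fstF_mem_FP qAccFn_mem_FP)) (const_mem_FP _)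
    (iteFn_mem_FP (comp_mem_FP isNilFn_mem_FP qSignParFn_mem_FP) (fanoutFn_mem_FP (qMagFn_mem_FP ℓ P C R2) (const_mem_FP _))
      (fanoutFn_mem_FP (const_mem_FP _) (qMagFn_mem_FP ℓ P C R2)))

end QFn

/-! ### The value of `Q` -/

section QValue

variable (ℓ P : ℕ) (C : ℕ → ℕ) (R2 : ℕ) (L : List (QGate iqpDiag N)) (l : List ℕ) (x : List Bool)

/-- The basis input read off the input bits: `z_i = x[i]` (`0` beyond `|x|`, i.e. the padding
`|x⟩|0…0⟩` of `IQPFamily.kernel`). [folklore] -/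
def zOfInput (N : ℕ) (x : List Bool) : QReg N := fun i => x.getD i false

/-- `supp` of the tuple shift is the coded subset. [folklore] -/
theorem supp_tupleShift : supp (tupleShift N l) = tupleSet N l := by
  ext i; simp [supp, tupleShift, tupleSet]

/-- `anyZero` read through `wireTripleAt`. [folklore] -/
theorem anyZero_iff_exists : anyZero L (tupleShift N l) ↔ ∃ j, j < N ∧ (wireTripleAt L l j).1 = true := by
  unfold anyZero
  constructor
  · rintro ⟨i, hi⟩
    refine ⟨i, i.2, ?_⟩
    rw [wireTripleAt, dif_pos i.2]
    exact (wireTriple_spec _ _ _).1.2 hi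
  · rintro ⟨j, hj, h⟩
    refine ⟨⟨j, hj⟩, ?_⟩
    rw [wireTripleAt, dif_pos hj] at h
    exact (wireTriple_spec _ _ _).1.1 h

/-- Without a zero, the accumulated exponents are `(Σe mod 4, Σa)`. [folklore] -/
theorem sums_wireTripleAt (h : ¬ anyZero L (tupleShift N l)) :
    (∑ j ∈ Finset.range N, (wireTripleAt L l j).2.1) = totE L (tupleShift N l) ∧
    (∑ j ∈ Finset.range N, (wireTripleAt L l j).2.2) = totA L (tupleShift N l) := by
  have key : ∀ i : Fin N, (wireTripleAt L l i).2 = (wireCodeAt L (tupleShift N l) i).getD (0, 0) := by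
    intro i
    unfold anyZero at h
    push Not at h
    obtain ⟨⟨e, a⟩, hea⟩ := Option.ne_none_iff_exists'.1 (h i)
    rw [wireTripleAt, dif_pos i.2, hea]
    exact (wireTriple_spec _ _ _).2.1 e a hea
  constructor
  · rw [totE, ← Fin.sum_univ_eq_sum_range (fun j => (wireTripleAt L l j).2.1)]
    exact Finset.sum_congr rfl fun i _ => by rw [← key i]
  · rw [totA, ← Fin.sum_univ_eq_sum_range (fun j => (wireTripleAt L l j).2.2)]
    exact Finset.sum_congr rfl fun i _ => by rw [← key i]

/-- Value of the accumulated triple. [folklore] -/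
theorem accTriple_wireTripleAt :
    accTriple (wireTripleAt L l) 0 N (false, 0, 0) =
      (decide (anyZero L (tupleShift N l)), (∑ j ∈ Finset.range N, (wireTripleAt L l j).2.1) % 4,
        ∑ j ∈ Finset.range N, (wireTripleAt L l j).2.2) := by
  rw [accTriple_closed _ 0 (false, 0, 0) (by norm_num) N]
  simp only [zero_add, Bool.false_or, Prod.mk.injEq, and_true]
  rw [decide_eq_decide, anyZero_iff_exists]

variable {L l x}

/-- Value of `qSignParFn` (no zero). [folklore] -/
theorem qSignParFn_apply (h : ¬ anyZero L (tupleShift N l)) :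
    qSignParFn (qArg x N (encList (L.map QGate.encode)) (tupleCode l)) =
      ones ((zOnShift L (tupleShift N l) + czInShift L (tupleShift N l) +
        l.countP (fun p => x.getD p false = true) + totE L (tupleShift N l) % 4 / 2) % 2) := by
  have hacc := qAccFn_qArg L l x
  rw [accTriple_wireTripleAt, (sums_wireTripleAt L l h).1] at hacc
  simp only [qSignParFn, qZOnFn, qCzInFn, qMarkFn, qEHalfFn, qStat0Fn, Function.comp_apply, fanoutFn_apply,
    qRulerOf_qArg, qGOf_qArg, qXOf_qArg, sndF_qArg, hacc, tripleCode, nthF, fstF_boolPair, sndF_boolPair,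
    divKFn_apply, List.length_replicate, appF_boolPair, modKFn_apply, List.length_append]
  rw [show boolPair (ones N) (boolPair [] (tupleCode l)) = statCtx N 0 (tupleCode l) by rfl,
    zOnFn_apply, czInFn_apply, markedCountFn_apply, ← zOnShift_eq_countP, ← czInShift_eq_countP]
  simp only [List.length_replicate]
  rw [← Nat.add_assoc]

/-- Value of `qCSelFn` (tuple of length `≤ ℓ`, canonical). [folklore] -/
theorem qCSelFn_apply (hcanon : IsCanon N l) (hle : ∀ q ∈ l, q ≤ N) (hl : l.length ≤ ℓ) :
    qCSelFn ℓ C (qArg x N (encList (L.map QGate.encode)) (tupleCode l)) = encodeNat (C (tupleSet N l).card) := by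
  simp only [qCSelFn, qSizeFn, Function.comp_apply, fanoutFn_apply, qRulerOf_qArg, sndF_qArg, sizeFn_apply,
    HashBricks.nthItemFn_boolPair, List.length_replicate]
  rw [countP_ne_eq_length_nonBlank hle, ← card_tupleSet hcanon hle]
  have hcard : (tupleSet N l).card ≤ ℓ := by
    rw [card_tupleSet hcanon hle]; exact (List.length_filter_le _ _).trans hl
  have hk : (tupleSet N l).card < (List.range (ℓ + 1)).length := by simp; omega
  rw [sndF_iterate_encList, fstF_encList, ← List.map_drop, List.drop_eq_getElem_cons hk, List.map_cons, List.headD_cons,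
    List.getElem_range]

/-- Value of `qMagFn` (no zero, canonical tuple of length `≤ ℓ`). [folklore] -/
theorem qMagFn_apply (h : ¬ anyZero L (tupleShift N l)) (hcanon : IsCanon N l) (hle : ∀ q ∈ l, q ≤ N) (hl : l.length ≤ ℓ) :
    qMagFn ℓ P C R2 (qArg x N (encList (L.map QGate.encode)) (tupleCode l)) =
      encodeNat (C (tupleSet N l).card * 2 ^ (totA L (tupleShift N l) / 2) *
        (if totA L (tupleShift N l) % 2 = 0 then 2 ^ P else R2)) := by
  have hacc := qAccFn_qArg L l x
  rw [accTriple_wireTripleAt, (sums_wireTripleAt L l h).2] at hacc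
  have hApar : qAParFn (qArg x N (encList (L.map QGate.encode)) (tupleCode l)) = ones (totA L (tupleShift N l) % 2) := by
    simp [qAParFn, hacc, tripleCode, sndPow]
  have hAhalf : qAHalfFn (qArg x N (encList (L.map QGate.encode)) (tupleCode l)) = ones (totA L (tupleShift N l) / 2) := by
    simp [qAHalfFn, hacc, tripleCode, sndPow]
  have hshift : qShiftCFn P R2 (qArg x N (encList (L.map QGate.encode)) (tupleCode l)) =
      encodeNat (if totA L (tupleShift N l) % 2 = 0 then 2 ^ P else R2) := by
    unfold qShiftCFn
    rw [iteFn_apply (b := decide (totA L (tupleShift N l) % 2 = 0))]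
    · by_cases hc : totA L (tupleShift N l) % 2 = 0 <;> simp [hc]
    · rw [Function.comp_apply, hApar]
      simp only [isNilFn]
      congr 1
      rw [decide_eq_decide]
      constructor
      · intro h0; simpa using congrArg List.length h0
      · intro h0; rw [h0]; rfl
  have hpow : qPow2Fn (qArg x N (encList (L.map QGate.encode)) (tupleCode l)) =
      List.replicate (totA L (tupleShift N l) / 2) false ++ [true] := by
    rw [qPow2Fn, hAhalf, Kannan.zerosFn_apply, List.length_replicate]
  simp only [qMagFn, Function.comp_apply, fanoutFn_apply, qCSelFn_apply ℓ C hcanon hle hl, hshift, hpow,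
    prodFn_boolPair, bitsToNat_encodeNat, bitsToNat_append, bitsToNat_replicate_false, List.length_replicate]
  simp only [bitsToNat_cons, bitsToNat_nil, Bool.toNat_true, mul_zero, add_zero, zero_add, mul_one]
  congr 1
  split_ifs <;> ring

/-- The sign of `coefInt` as a parity. [folklore] -/
theorem coefSign_eq_neg_one_pow (hcanon : IsCanon N l) (hle : ∀ q ∈ l, q ≤ N) (hx : x.length ≤ N) :
    coefSign L (zOfInput N x) (tupleShift N l) =
      (-1) ^ (zOnShift L (tupleShift N l) + czInShift L (tupleShift N l) + l.countP (fun p => x.getD p false = true) +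
        totE L (tupleShift N l) % 4 / 2) := by
  have hprod : (∏ i ∈ supp (zOfInput N x), (if tupleShift N l i = true then (-1 : ℤ) else 1)) =
      (-1) ^ (l.countP fun p => x.getD p false = true) := by
    rw [Finset.prod_ite, Finset.prod_const_one, mul_one, Finset.prod_const, countP_marked_eq_card hcanon hle x hx]
    congr 1
    refine Finset.card_bij (fun i _ => i) ?_ (fun _ _ _ _ h => h) ?_
    · intro i hi
      simp only [Finset.mem_filter, supp, Finset.mem_univ, true_and, zOfInput, tupleShift_apply,
        decide_eq_true_eq] at hi ⊢
      exact ⟨mem_tupleSet.2 hi.2, hi.1⟩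
    · intro i hi
      simp only [Finset.mem_filter, supp, Finset.mem_univ, true_and, zOfInput, tupleShift_apply,
        decide_eq_true_eq] at hi ⊢
      exact ⟨i, ⟨hi.2, mem_tupleSet.1 hi.1⟩, rfl⟩
  unfold coefSign
  rw [hprod, ← pow_add]
  congr 1
  omega

/-- `dpEnc` of a natural number (twin of `…Cryptography.dpEnc_natCast` of
`Cryptography/PolyTimeComputableReals.lean`, outside this file's import closure). [folklore] -/
theorem dpEnc_natCast' (m : ℕ) : dpEnc (m : ℤ) = boolPair (encodeNat m) [] := by
  rw [dpEnc, Int.toNat_natCast, Int.toNat_neg_natCast]; rfl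

/-- `dpEnc` of a negated natural number. [folklore] -/
theorem dpEnc_neg_natCast' (m : ℕ) : dpEnc (-(m : ℤ)) = boolPair [] (encodeNat m) := by
  rw [dpEnc, Int.toNat_neg_natCast, neg_neg, Int.toNat_natCast]; rfl

/-- **The machine computes the integer coefficient**: for a canonical tuple of length `≤ ℓ`
(entries `≤ N`) and input bits `x` (`|x| ≤ N`),
`qFn ⟨⟨x, ⟨1^N, G⟩⟩, tupleCode l⟩ = dpEnc (coefInt P C R2 gates z S)`.
[cite: BremnerMontanaroShepherd2017, §3.1 (the stored coefficients)] -/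
theorem qFn_apply (hcanon : IsCanon N l) (hle : ∀ q ∈ l, q ≤ N) (hl : l.length ≤ ℓ) (hx : x.length ≤ N) :
    qFn ℓ P C R2 (qArg x N (encList (L.map QGate.encode)) (tupleCode l)) =
      dpEnc (coefInt P C R2 L (zOfInput N x) (tupleShift N l)) := by
  have hacc := qAccFn_qArg L l x
  rw [accTriple_wireTripleAt] at hacc
  have hzbit : (bitIsTrueFn ∘ fstF ∘ qAccFn) (qArg x N (encList (L.map QGate.encode)) (tupleCode l)) =
      [decide (anyZero L (tupleShift N l))] := by
    rw [Function.comp_apply, Function.comp_apply, hacc, tripleCode, fstF_boolPair, bitIsTrueFn_apply]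
    by_cases hz : anyZero L (tupleShift N l) <;> simp [hz]
  unfold qFn
  rw [iteFn_apply hzbit]
  by_cases hz : anyZero L (tupleShift N l)
  · rw [if_pos (decide_eq_true hz), coefInt, if_pos hz]
  rw [if_neg (fun h => hz (of_decide_eq_true h)), coefInt, if_neg hz, supp_tupleShift]
  have hpartest : (isNilFn ∘ qSignParFn) (qArg x N (encList (L.map QGate.encode)) (tupleCode l)) =
      [decide ((zOnShift L (tupleShift N l) + czInShift L (tupleShift N l) +
        l.countP (fun p => x.getD p false = true) + totE L (tupleShift N l) % 4 / 2) % 2 = 0)] := by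
    rw [Function.comp_apply, qSignParFn_apply hz, isNilFn_ones]
  rw [iteFn_apply hpartest]
  by_cases hp : (zOnShift L (tupleShift N l) + czInShift L (tupleShift N l) +
      l.countP (fun p => x.getD p false = true) + totE L (tupleShift N l) % 4 / 2) % 2 = 0
  · rw [if_pos (decide_eq_true hp), fanoutFn_apply, qMagFn_apply ℓ P C R2 hz hcanon hle hl,
      coefSign_eq_neg_one_pow hcanon hle hx, neg_one_pow_eq_pow_mod_two, hp, pow_zero, one_mul]
    exact (dpEnc_natCast' _).symm
  · have hp1 := Nat.mod_two_ne_zero.mp hp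
    rw [if_neg (fun h => hp (of_decide_eq_true h)), fanoutFn_apply, qMagFn_apply ℓ P C R2 hz hcanon hle hl,
      coefSign_eq_neg_one_pow hcanon hle hx, neg_one_pow_eq_pow_mod_two, hp1, pow_one, neg_one_mul]
    exact (dpEnc_neg_natCast' _).symm

end QValue

end Literature.Barriers.QuantumAdvantage.NoisyIQPMachine
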